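import Literature.AlgebraicGeometry.Motives.SegreHyperplaneClass
import HarnessLib

/-!
# The `K`-symmetric weighted Segre embedding of `A × E` (one curve factor)

Layer `Literature/AlgebraicGeometry/Motives`, companion of `Motives/SegreHyperplaneClass`, whose
`exists_symmetricSegreEmbedding` is the three-factor version `A × (E × E)` with two weights (the CM
surface partner of the product trick, Markman arXiv:2509.23403 §11.5 Step 2). Here: the two-factor
version `A × E` with ONE weight `m` — the polarization `L_A ⊠ L_E^{⊗m}` of a product with a curve
(R. Hartshorne, *Algebraic Geometry* II Ex. 5.11–5.12: `σ^*𝒪(1) ≅ 𝒪(1,1)`; the Segre–diagonal power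
`s_{m-1}` with `s_{m-1}^* 𝒪(1) = 𝒪(m)`), as used for the Weil-type products `E_k × X₂` of
Moonen–Zarhin (Math. Ann. 315 (1999), Thm. 0.1 case (a)): "a product polarization `a·L_E ⊠ b·L₂`".

* `exists_symmetricSegreEmbedding_prodCurve` — for `(A, φ)` with `φ ≫ φ = -(d • 𝟙)`, `d ≥ 1`, a
  complex elliptic curve `E` and a non-zero rational `η ∈ H²(E(ℂ); ℂ)`: a projective embedding `e_A`
  of `A` and a non-zero rational `a_A` with `K`-SYMMETRIC hyperplane class `h_A = e_A^* a_A`,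
  `φ^* h_A = d h_A`, and a rational `s` such that for every weight `m ≥ 1` the Segre embedding of
  `e_A` with `s_{m-1}(e_E)` is a projective embedding of `A × E` with hyperplane class
  `pr_A^* h_A + s·m · pr_E^* η`.

Everything is proved; no definition and no named fact is introduced. The proof is the two-factor
specialisation of the tree's `exists_symmetricSegreEmbedding` (same ingredients:
`exists_segreHyperplaneClasses`, `map_segrePow_of_additive`, `exists_closedImmersion_projectiveSpace_pos`,
`exists_eq_ratCast_smul_of_curve`, `complexBetti_map_neg_nsmul_id_two`).

## References

* [Hartshorne1977] R. Hartshorne, Algebraic Geometry (1977), II Ex. 5.11 and Ex. 5.12.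
* [Markman2025SurveySecant] E. Markman, arXiv:2509.23403, §11.5 Step 2.
* [MoonenZarhin1999LowDim] B. Moonen, Yu. Zarhin, Math. Ann. 315 (1999), Thm. 0.1 (a).
-/

noncomputable section

open CategoryTheory AlgebraicGeometry MonoidalCategory CartesianMonoidalCategory Function
open Literature.AlgebraicGeometry Literature.AlgebraicGeometry.Motives
  Literature.AlgebraicGeometry.HodgeTheory Literature.AlgebraicTopology.SingularHomology

namespace Literature.AlgebraicGeometry.Motives

open SegreHyperplaneClass

/-- **The `K`-symmetric weighted Segre embedding of `A × E`** (Hartshorne II Ex. 5.11–5.12; the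
product polarization `L_A ⊠ L_E^{⊗m}`, Moonen–Zarhin 1999 Thm. 0.1 (a) / Markman §11.5 Step 2 with one
curve factor). For `(A, φ)` with `φ ≫ φ = -(d • 𝟙)`, `d ≥ 1`, a complex elliptic curve `E` and a
non-zero rational `η ∈ H²(E(ℂ); ℂ)`: a projective embedding `e_A` of `A` and a non-zero rational
`a_A ∈ H²(ℙᴺ(ℂ))` whose hyperplane class `h_A = e_A^* a_A` is `K`-symmetric, `φ^* h_A = d h_A` (the
Segre embedding of the graph of `φ` in `s_{d-1}(e₀) × e₀`, class `d h₀ + φ^* h₀`, with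
`φ^*φ^* = (-[d])^* = d²` on `H²`), and a rational `s` such that for all weights `m ≥ 1` the Segre
embedding of `e_A` with `s_{m-1}(e_E)` has hyperplane class `pr_A^* h_A + s · m · pr_E^* η`.
[cite: Hartshorne1977, II Ex. 5.11 and Ex. 5.12] [cite: Markman2025SurveySecant, §11.5 Step 2]
[cite: MoonenZarhin1999LowDim, Thm. 0.1 (a)] -/
theorem exists_symmetricSegreEmbedding_prodCurve {d : ℕ} (hd : 0 < d) {A : AbelianVariety ℂ} {φ : A ⟶ A}
    (hφ : φ ≫ φ = -(d • 𝟙 A)) (E : AbelianVariety ℂ) (hE : E.dim = 1)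
    (η : complexBetti E.X 2) (hη : IsRationalClass η) (hη0 : η ≠ 0) :
    ∃ (eA : ProjectiveEmbedding A.X) (aA : complexBetti (projectiveSpace eA.n ℂ) 2) (s : ℚ),
      IsRationalClass aA ∧ aA ≠ 0 ∧
      complexBetti.map φ.hom.hom.hom 2 (complexBetti.map eA.ι 2 aA) = (d : ℂ) • complexBetti.map eA.ι 2 aA ∧
      ∀ m : ℕ, 0 < m →
        ∃ (e : ProjectiveEmbedding (A.prod E).X) (a : complexBetti (projectiveSpace e.n ℂ) 2),
          IsRationalClass a ∧ a ≠ 0 ∧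
          complexBetti.map e.ι 2 a =
            complexBetti.map (AbelianVariety.fst A E).hom.hom.hom 2 (complexBetti.map eA.ι 2 aA) +
            ((s * m : ℚ) : ℂ) • complexBetti.map (AbelianVariety.snd A E).hom.hom.hom 2 η := by
  obtain ⟨d', rfl⟩ : ∃ d', d = d' + 1 := ⟨d - 1, by omega⟩
  clear hd
  obtain ⟨g, hgr, hgnz, hgσ⟩ := exists_segreHyperplaneClasses
  obtain ⟨N, e₀, hN, he₀⟩ := exists_closedImmersion_projectiveSpace_pos A
  obtain ⟨M, f₀, hM, hf₀⟩ := exists_closedImmersion_projectiveSpace_pos E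
  haveI := he₀
  haveI := hf₀
  -- the `K`-symmetric embedding of `A`: graph of `φ`, then `s_{d'}(e₀) × e₀`, then Segre
  obtain ⟨ιA, hιA⟩ : ∃ ι : A.X ⟶ projectiveSpace (ProjectiveSpace.segrePowDim N d' * N + ProjectiveSpace.segrePowDim N d' + N) ℂ,
      ι = CartesianMonoidalCategory.lift (𝟙 A.X) φ.hom.hom.hom ≫
        ((e₀ ≫ ProjectiveSpace.segrePow N ℂ d') ⊗ₘ e₀) ≫ segreEmbedding (ProjectiveSpace.segrePowDim N d') N ℂ := ⟨_, rfl⟩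
  haveI := isClosedImmersion_segrePow_left N d'
  haveI : IsClosedImmersion (e₀ ≫ ProjectiveSpace.segrePow N ℂ d').left := by
    change IsClosedImmersion (e₀.left ≫ (ProjectiveSpace.segrePow N ℂ d').left); infer_instance
  haveI := isClosedImmersion_tensorHom_left (e₀ ≫ ProjectiveSpace.segrePow N ℂ d') e₀
  haveI := isClosedImmersion_lift_id_left (X := A.X) (Y := A.X) φ.hom.hom.hom
  haveI hιAci : IsClosedImmersion ιA.left := by
    rw [hιA]
    change IsClosedImmersion ((CartesianMonoidalCategory.lift (𝟙 A.X) φ.hom.hom.hom).left ≫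
      (((e₀ ≫ ProjectiveSpace.segrePow N ℂ d') ⊗ₘ e₀).left ≫ (segreEmbedding (ProjectiveSpace.segrePowDim N d') N ℂ).left))
    infer_instance
  let eA : ProjectiveEmbedding A.X := ⟨_, ιA, hιAci⟩
  obtain ⟨h₀, hh₀⟩ : ∃ h : complexBetti A.X 2, h = complexBetti.map e₀ 2 (g N) := ⟨_, rfl⟩
  have hA : complexBetti.map ιA 2 (g (ProjectiveSpace.segrePowDim N d' * N + ProjectiveSpace.segrePowDim N d' + N)) =
      ((d' + 1 : ℕ) : ℂ) • h₀ + complexBetti.map φ.hom.hom.hom 2 h₀ := by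
    rw [hιA, map_comp_apply', map_comp_apply', hgσ (ProjectiveSpace.segrePowDim N d') N, map_add, map_add,
      map_tensorHom_map_fst, map_tensorHom_map_snd, map_lift_map_fst, map_lift_map_snd, complexBetti.map_id,
      ModuleCat.id_apply, map_comp_apply', map_segrePow_of_additive g hgσ N d', map_smul, ← hh₀]
  -- the curve: `f₀^* g = s • η`
  obtain ⟨s, hs⟩ := exists_eq_ratCast_smul_of_curve E hE hη hη0 ((hgr M).pullback (AlgPoints.mapContinuous (L := ℂ) f₀))
  have hKA : 1 ≤ ProjectiveSpace.segrePowDim N d' * N + ProjectiveSpace.segrePowDim N d' + N := le_trans hN (Nat.le_add_left _ _)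
  refine ⟨eA, g _, s, hgr _, hgnz _ hKA, ?_, fun m hm ↦ ?_⟩
  · -- `φ^* h_A = d h_A`
    change complexBetti.map φ.hom.hom.hom 2
        (complexBetti.map ιA 2 (g (ProjectiveSpace.segrePowDim N d' * N + ProjectiveSpace.segrePowDim N d' + N))) =
      ((d' + 1 : ℕ) : ℂ) • complexBetti.map ιA 2 (g (ProjectiveSpace.segrePowDim N d' * N + ProjectiveSpace.segrePowDim N d' + N))
    have hcomp : φ.hom.hom.hom ≫ φ.hom.hom.hom = (φ ≫ φ).hom.hom.hom := rfl
    rw [hA, map_add, map_smul, ← map_comp_apply', hcomp, hφ, complexBetti_map_neg_nsmul_id_two, smul_add, smul_smul,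
      ← pow_two, add_comm]
  · -- the weighted Segre embedding of `A × E`
    obtain ⟨d₁, rfl⟩ : ∃ d, m = d + 1 := ⟨m - 1, by omega⟩
    obtain ⟨ιE, hιE⟩ : ∃ ι : E.X ⟶ projectiveSpace (ProjectiveSpace.segrePowDim M d₁) ℂ,
        ι = f₀ ≫ ProjectiveSpace.segrePow M ℂ d₁ := ⟨_, rfl⟩
    haveI := isClosedImmersion_segrePow_left M d₁
    haveI hιEci : IsClosedImmersion ιE.left := by
      rw [hιE]
      change IsClosedImmersion (f₀.left ≫ (ProjectiveSpace.segrePow M ℂ d₁).left)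
      infer_instance
    obtain ⟨ι, hι⟩ : ∃ ι : A.X ⊗ E.X ⟶ projectiveSpace
        ((ProjectiveSpace.segrePowDim N d' * N + ProjectiveSpace.segrePowDim N d' + N) *
          ProjectiveSpace.segrePowDim M d₁ +
          (ProjectiveSpace.segrePowDim N d' * N + ProjectiveSpace.segrePowDim N d' + N) +
          ProjectiveSpace.segrePowDim M d₁) ℂ,
        ι = (ιA ⊗ₘ ιE) ≫ segreEmbedding _ _ ℂ := ⟨_, rfl⟩
    haveI := isClosedImmersion_tensorHom_left (X := A.X) (Y := E.X) ιA ιE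
    have hιci : IsClosedImmersion ι.left := by
      rw [hι]
      change IsClosedImmersion ((ιA ⊗ₘ ιE).left ≫ (segreEmbedding _ _ ℂ).left)
      infer_instance
    have hKK : 1 ≤ (ProjectiveSpace.segrePowDim N d' * N + ProjectiveSpace.segrePowDim N d' + N) *
          ProjectiveSpace.segrePowDim M d₁ +
          (ProjectiveSpace.segrePowDim N d' * N + ProjectiveSpace.segrePowDim N d' + N) +
          ProjectiveSpace.segrePowDim M d₁ :=
      le_trans hKA ((Nat.le_add_left _ _).trans (Nat.le_add_right _ _))
    refine ⟨⟨_, ι, hιci⟩, g _, hgr _, hgnz _ hKK, ?_⟩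
    -- `ι_E^* g = m · f₀^* g = m s · η`
    have hEcl : complexBetti.map ιE 2 (g _) = ((d₁ + 1 : ℕ) : ℂ) • complexBetti.map f₀ 2 (g M) := by
      rw [hιE, map_comp_apply', map_segrePow_of_additive g hgσ M d₁, map_smul]
    have final : complexBetti.map ι 2 (g _) =
        complexBetti.map (fst A.X E.X) 2
            (complexBetti.map ιA 2 (g (ProjectiveSpace.segrePowDim N d' * N + ProjectiveSpace.segrePowDim N d' + N))) +
          ((s * ((d₁ + 1 : ℕ) : ℚ) : ℚ) : ℂ) • complexBetti.map (snd A.X E.X) 2 η := by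
      rw [hι, map_comp_apply', hgσ, map_add, map_tensorHom_map_fst, map_tensorHom_map_snd, hEcl, hs]
      simp only [map_smul, smul_smul]
      push_cast
      ring_nf
    exact final

end Literature.AlgebraicGeometry.Motives

end
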